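import Summits.ValiantsHypothesis.ValiantsHypothesis.Theorems.SymPencilPerFourOneRowKernelPlane
import Summits.ValiantsHypothesis.ValiantsHypothesis.Theorems.SymPencilSingSixClassificationToric

/-!
# Route `SymPencil` — leaf R1N of the `(11, 5, 4)` cascade, §6.6 TORIC branch, hyperplane case
# (`--supports` stmt-ValiantsHypothesis-5674 `SdcSuperquadratic`; memo `SING-FIVE-CLASSIFICATION.md` §6.6 (T-hyp), for the
# residual `stub_threeRowsFourCols` of `Cruxes/SdcSuperquadratic/Lines/sing_five_classification.lean`; rung currency only)

Setting (normalised): `W ⊆ K^{4×4}` singular (`Sing3`), `dim W = 5`, zero row `0`, live rows `1, 2, 3` with row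
spaces `A_x = W.map (rowL x)` ALL of dimension `2` (the case `dim Π = 6` of memo §6.6, `Π = A₁ × A₂ × A₃`).

* `T3_vanish_of_hyperplane` — the trilinear-extension step: if `T3` vanishes on the hyperplane
  `{θ_A a + θ_B b + θ_C c = 0}` of `A × B × C` and `θ_A|A, θ_B|B ≠ 0`, then `T3 ≡ 0` on `A × B × C`
  (polynomial identity along `(a + x a₁, b + y b₁, c)`);
* `toric_hyp_absurd` — `W` is a hyperplane of `Π` (or all of a product), at least two of the three functionals
  are non-zero, so `T3 ≡ 0` on `A₁ × A₂ × A₃`; ✓ `toricTriple permOrthPairs` then gives two common zero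
  coordinates, i.e. a zero column of `W` — excluded by the no-zero-column hypothesis.

Honest framing: [folklore] linear algebra for ONE sub-case of ONE leaf of ONE of four open size-27 cells; leaf R1N and
the cell file remain OPEN; `27 ≤ sdc(per₄) ≤ 29` unchanged; the crux `SdcSuperquadratic` and `VP ≠ VNP` untouched; no
summit statement is proved here.  No definitions, no named facts.
-/

noncomputable section

set_option linter.dupNamespace false

namespace Summit.ValiantsHypothesis.ValiantsHypothesis.Theorems.SymPencilPerFourOneRowToric

open Module MvPolynomial
open Literature.Computability.AlgebraicComplexity
open Summit.ValiantsHypothesis.ValiantsHypothesis.Theorems.SymPencilSingSixClassification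
open Summit.ValiantsHypothesis.ValiantsHypothesis.Theorems.SymPencilPerFourOneRowKernelPlane

variable {K : Type*} [Field K]

/-! ## 1. Trilinear extension across a hyperplane -/

/-- **Trilinear extension** (memo §6.6 (T-hyp)).  Let `θ_A, θ_B, θ_C` be linear functionals with `θ_A ≢ 0` on
`A` and `θ_B ≢ 0` on `B`.  If `T3 a b c = 0` whenever `a ∈ A, b ∈ B, c ∈ C` and `θ_A a + θ_B b + θ_C c = 0`,
then `T3 a b c = 0` for ALL `a ∈ A, b ∈ B, c ∈ C`. [folklore] -/
theorem T3_vanish_of_hyperplane [CharZero K] (A B C : Submodule K (Fin 4 → K))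
    (θA θB θC : (Fin 4 → K) →ₗ[K] K)
    (hA : ∃ a₀ ∈ A, θA a₀ ≠ 0) (hB : ∃ b₀ ∈ B, θB b₀ ≠ 0)
    (hW : ∀ a ∈ A, ∀ b ∈ B, ∀ c ∈ C, θA a + θB b + θC c = 0 → ∀ l, T3 a b c l = 0) :
    ∀ a ∈ A, ∀ b ∈ B, ∀ c ∈ C, ∀ l, T3 a b c l = 0 := by
  obtain ⟨a₀, ha₀, hθa₀⟩ := hA
  obtain ⟨b₀, hb₀, hθb₀⟩ := hB
  obtain ⟨a₁, ha₁_def⟩ : ∃ a₁ : Fin 4 → K, a₁ = (θA a₀)⁻¹ • a₀ := ⟨_, rfl⟩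
  obtain ⟨b₁, hb₁_def⟩ : ∃ b₁ : Fin 4 → K, b₁ = (θB b₀)⁻¹ • b₀ := ⟨_, rfl⟩
  have ha₁ : a₁ ∈ A := ha₁_def ▸ A.smul_mem _ ha₀
  have hb₁ : b₁ ∈ B := hb₁_def ▸ B.smul_mem _ hb₀
  have hθa₁ : θA a₁ = 1 := by rw [ha₁_def, map_smul, smul_eq_mul, inv_mul_cancel₀ hθa₀]
  have hθb₁ : θB b₁ = 1 := by rw [hb₁_def, map_smul, smul_eq_mul, inv_mul_cancel₀ hθb₀]
  intro a ha b hb c hc l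
  have key : ∀ b ∈ B, ∀ x : K,
      x * T3 a₁ b c l + x * (-(θB b + θC c) - x) * T3 a₁ b₁ c l = 0 := by
    intro b hb x
    have hmem := hW (x • a₁) (A.smul_mem _ ha₁) (b + (-(θB b + θC c) - x) • b₁)
      (B.add_mem hb (B.smul_mem _ hb₁)) c hc (by
        rw [map_smul, map_add, map_smul, hθa₁, hθb₁, smul_eq_mul, smul_eq_mul]; ring) l
    rw [T3_smul₁, T3_add₂, T3_smul₂] at hmem
    linear_combination hmem
  have h11 : T3 a₁ b₁ c l = 0 := by
    have h1 := key b₁ hb₁ 1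
    have h2 := key b₁ hb₁ (-1)
    rw [hθb₁] at h1 h2
    have h3 : (2 : K) * T3 a₁ b₁ c l = 0 := by linear_combination -(h1 + h2)
    exact (mul_eq_zero.1 h3).resolve_left two_ne_zero
  have hB₁ : T3 a b₁ c l = 0 := by
    have hmem := hW (a + (-(θA a + θC c + 1)) • a₁) (A.add_mem ha (A.smul_mem _ ha₁)) b₁ hb₁ c hc
      (by rw [map_add, map_smul, hθa₁, hθb₁, smul_eq_mul]; ring) l
    rwa [T3_add₁, T3_smul₁, h11, mul_zero, add_zero] at hmem
  have hmem := hW a ha (b + (-(θA a + θB b + θC c)) • b₁) (B.add_mem hb (B.smul_mem _ hb₁)) c hc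
    (by rw [map_add, map_smul, hθb₁, smul_eq_mul]; ring) l
  rwa [T3_add₂, T3_smul₂, hB₁, mul_zero, add_zero] at hmem

/-! ## 2. The hyperplane case of the toric branch -/

/-- **§6.6 (T-hyp): all three live rows of rank `2` is impossible.**  With zero row `0`, `dim W = 5`, `Sing3`, no zero
column and `dim A₁ = dim A₂ = dim A₃ = 2`: `W` embeds in `Π = A₁ × A₂ × A₃` (dimension `6`) as a hyperplane
`{θ₁ + θ₂ + θ₃ = 0}` (or `Π ≤ W`); since each projection `W → A_x` is onto, at most one `θ_x` vanishes, so
`T3_vanish_of_hyperplane` makes `T3 ≡ 0` on `A₁ × A₂ × A₃`, and the toric triple lemma (✓ `toricTriple permOrthPairs`)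
produces a common zero coordinate of `A₁, A₂, A₃`, i.e. a zero column of `W`. [folklore] -/
theorem toric_hyp_absurd [CharZero K] {W : Submodule K (Fin 4 × Fin 4 → K)} (hS : Sing3 W)
    (h5 : finrank K W = 5) (hi : ∀ y ∈ W, row y 0 = 0)
    (hcol : ∀ m, ∃ y ∈ W, ∃ x, y (x, m) ≠ 0)
    (hn1 : finrank K (W.map (rowL 1)) = 2) (hn2 : finrank K (W.map (rowL 2)) = 2)
    (hn3 : finrank K (W.map (rowL 3)) = 2) : False := by
  classical
  set A1 := W.map (rowL 1) with hA1_def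
  set A2 := W.map (rowL 2) with hA2_def
  set A3 := W.map (rowL 3) with hA3_def
  -- row embeddings `Em x a` = the matrix with row `x` equal to `a`, all other rows zero
  let Em : Fin 4 → (Fin 4 → K) →ₗ[K] (Fin 4 × Fin 4 → K) := fun x =>
    LinearMap.pi fun p => if p.1 = x then LinearMap.proj p.2 else 0
  have hEm : ∀ x a p, Em x a p = if p.1 = x then a p.2 else 0 := by
    intro x a p
    simp only [Em, LinearMap.pi_apply]
    split_ifs <;> simp
  have rowEm : ∀ x x' a, row (Em x a) x' = if x' = x then a else 0 := by
    intro x x' a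
    by_cases h : x' = x
    · rw [if_pos h]; funext j; simp [row, hEm, h]
    · rw [if_neg h]; funext j; simp [row, hEm, h]
  have rowE : ∀ a b c : Fin 4 → K,
      row (Em 1 a + Em 2 b + Em 3 c) 0 = 0 ∧ row (Em 1 a + Em 2 b + Em 3 c) 1 = a ∧
      row (Em 1 a + Em 2 b + Em 3 c) 2 = b ∧ row (Em 1 a + Em 2 b + Em 3 c) 3 = c := by
    intro a b c
    refine ⟨?_, ?_, ?_, ?_⟩ <;> simp [row_add, rowEm]
  -- the product `P = {row 0 = 0, row x ∈ A_x}`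
  set P : Submodule K (Fin 4 × Fin 4 → K) := LinearMap.ker (rowL 0) ⊓
    (A1.comap (rowL 1) ⊓ (A2.comap (rowL 2) ⊓ A3.comap (rowL 3))) with hP_def
  have hmemP : ∀ y, y ∈ P ↔ row y 0 = 0 ∧ row y 1 ∈ A1 ∧ row y 2 ∈ A2 ∧ row y 3 ∈ A3 := fun y => by
    simp only [hP_def, Submodule.mem_inf, LinearMap.mem_ker, Submodule.mem_comap, rowL_apply]
  have hWP : W ≤ P := fun y hy => (hmemP y).2
    ⟨hi y hy, Submodule.mem_map_of_mem hy, Submodule.mem_map_of_mem hy, Submodule.mem_map_of_mem hy⟩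
  have hEP : ∀ a ∈ A1, ∀ b ∈ A2, ∀ c ∈ A3, Em 1 a + Em 2 b + Em 3 c ∈ P := by
    intro a ha b hb c hc
    obtain ⟨h0, h1, h2, h3⟩ := rowE a b c
    exact (hmemP _).2 ⟨h0, by rw [h1]; exact ha, by rw [h2]; exact hb, by rw [h3]; exact hc⟩
  -- decomposition of an element with zero row `0`
  have hdecomp : ∀ y : Fin 4 × Fin 4 → K, row y 0 = 0 →
      y = Em 1 (row y 1) + Em 2 (row y 2) + Em 3 (row y 3) := by
    intro y hy
    funext ⟨i, j⟩
    have h0 : y (0, j) = 0 := congr_fun hy j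
    fin_cases i <;> simp [hEm, row, h0]
  -- `dim P ≤ 6`
  have hP6 : finrank K P ≤ 6 := by
    have c1 := finrank_kernel_add P 1
    have c2 := finrank_kernel_add (P ⊓ LinearMap.ker (rowL 1)) 2
    have c3 := finrank_kernel_add (P ⊓ LinearMap.ker (rowL 1) ⊓ LinearMap.ker (rowL 2)) 3
    have m1 : finrank K (P.map (rowL 1)) ≤ 2 := by
      rw [← hn1]
      apply Submodule.finrank_mono
      rintro _ ⟨y, hy, rfl⟩
      exact ((hmemP y).1 hy).2.1
    have m2 : finrank K ((P ⊓ LinearMap.ker (rowL 1)).map (rowL 2)) ≤ 2 := by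
      rw [← hn2]
      apply Submodule.finrank_mono
      rintro _ ⟨y, hy, rfl⟩
      exact ((hmemP y).1 (Submodule.mem_inf.1 hy).1).2.2.1
    have m3 : finrank K ((P ⊓ LinearMap.ker (rowL 1) ⊓ LinearMap.ker (rowL 2)).map (rowL 3)) ≤ 2 := by
      rw [← hn3]
      apply Submodule.finrank_mono
      rintro _ ⟨y, hy, rfl⟩
      exact ((hmemP y).1 (Submodule.mem_inf.1 (Submodule.mem_inf.1 hy).1).1).2.2.2
    have m4 : finrank K ↥(P ⊓ LinearMap.ker (rowL 1) ⊓ LinearMap.ker (rowL 2) ⊓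
        LinearMap.ker (rowL 3)) = 0 := by
      rw [Submodule.finrank_eq_zero]
      rw [eq_bot_iff]
      intro y hy
      rw [Submodule.mem_bot]
      have hy3 := (Submodule.mem_inf.1 hy).2
      have hy12 := (Submodule.mem_inf.1 hy).1
      have hy2 := (Submodule.mem_inf.1 hy12).2
      have hyP1 := (Submodule.mem_inf.1 hy12).1
      have hy1 := (Submodule.mem_inf.1 hyP1).2
      have hyP := (Submodule.mem_inf.1 hyP1).1
      rw [LinearMap.mem_ker, rowL_apply] at hy1 hy2 hy3
      have hy0 := ((hmemP y).1 hyP).1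
      funext ⟨i, j⟩
      fin_cases i
      · exact congr_fun hy0 j
      · exact congr_fun hy1 j
      · exact congr_fun hy2 j
      · exact congr_fun hy3 j
    omega
  -- `T3 ≡ 0` on `A1 × A2 × A3`
  have hT_of_mem : ∀ a b c, Em 1 a + Em 2 b + Em 3 c ∈ W → ∀ l, T3 a b c l = 0 := by
    intro a b c h l
    have h' := T3_eq_zero_of_sing3 hS h 1 2 3 (by decide) (by decide) (by decide) l
    obtain ⟨-, h1, h2, h3⟩ := rowE a b c
    rwa [h1, h2, h3] at h'
  have hT : ∀ a ∈ A1, ∀ b ∈ A2, ∀ c ∈ A3, ∀ l, T3 a b c l = 0 := by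
    by_cases hPW : P ≤ W
    · exact fun a ha b hb c hc => hT_of_mem a b c (hPW (hEP a ha b hb c hc))
    · obtain ⟨p₀, hp₀P, hp₀W⟩ := Set.not_subset.1 hPW
      obtain ⟨f, hf1, hfW⟩ := Submodule.exists_dual_map_eq_bot_of_notMem hp₀W inferInstance
      have hWk : ∀ y ∈ W, f y = 0 := fun y hy => by
        have h := Submodule.mem_map_of_mem (f := f) hy
        rw [hfW, Submodule.mem_bot] at h
        exact h
      -- `W = P ∩ ker f`
      have hPk : ∀ y ∈ P, f y = 0 → y ∈ W := by
        have hle : W ≤ P ⊓ LinearMap.ker f := le_inf hWP fun y hy => hWk y hy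
        have hlt : P ⊓ LinearMap.ker f < P := by
          refine lt_of_le_of_ne inf_le_left fun h => hf1 ?_
          have hp : p₀ ∈ P ⊓ LinearMap.ker f := by rw [h]; exact hp₀P
          exact (Submodule.mem_inf.1 hp).2
        have hdim := Submodule.finrank_lt_finrank_of_lt hlt
        have heq : W = P ⊓ LinearMap.ker f :=
          Submodule.eq_of_le_of_finrank_le hle (by omega)
        intro y hy hfy
        rw [heq]
        exact ⟨hy, hfy⟩
      have key : ∀ a ∈ A1, ∀ b ∈ A2, ∀ c ∈ A3,
          f (Em 1 a) + f (Em 2 b) + f (Em 3 c) = 0 → ∀ l, T3 a b c l = 0 := by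
        intro a ha b hb c hc h
        apply hT_of_mem
        apply hPk _ (hEP a ha b hb c hc)
        rw [map_add, map_add, h]
      have hsumW : ∀ y ∈ W, f (Em 1 (row y 1)) + f (Em 2 (row y 2)) + f (Em 3 (row y 3)) = 0 := by
        intro y hy
        rw [← map_add, ← map_add, ← hdecomp y (hi y hy)]
        exact hWk y hy
      -- at most one of the three functionals vanishes on its row space
      have hnot : ¬ ((∀ a ∈ A1, f (Em 1 a) = 0) ∧ (∀ b ∈ A2, f (Em 2 b) = 0) ∧
          (∀ c ∈ A3, f (Em 3 c) = 0)) := by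
        rintro ⟨z1, z2, z3⟩
        apply hf1
        obtain ⟨h0, h1, h2, h3⟩ := (hmemP p₀).1 hp₀P
        rw [hdecomp p₀ h0, map_add, map_add, z1 _ h1, z2 _ h2, z3 _ h3, add_zero, add_zero]
      have two23 : (∀ b ∈ A2, f (Em 2 b) = 0) → (∀ c ∈ A3, f (Em 3 c) = 0) → False := by
        intro z2 z3
        refine hnot ⟨fun a ha => ?_, z2, z3⟩
        obtain ⟨y, hy, rfl⟩ := Submodule.mem_map.1 ha
        have h := hsumW y hy
        have e2 : f (Em 2 (row y 2)) = 0 := z2 _ (Submodule.mem_map_of_mem hy)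
        have e3 : f (Em 3 (row y 3)) = 0 := z3 _ (Submodule.mem_map_of_mem hy)
        rwa [e2, e3, add_zero, add_zero] at h
      have two13 : (∀ a ∈ A1, f (Em 1 a) = 0) → (∀ c ∈ A3, f (Em 3 c) = 0) → False := by
        intro z1 z3
        refine hnot ⟨z1, fun b hb => ?_, z3⟩
        obtain ⟨y, hy, rfl⟩ := Submodule.mem_map.1 hb
        have h := hsumW y hy
        have e1 : f (Em 1 (row y 1)) = 0 := z1 _ (Submodule.mem_map_of_mem hy)
        have e3 : f (Em 3 (row y 3)) = 0 := z3 _ (Submodule.mem_map_of_mem hy)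
        rwa [e1, e3, zero_add, add_zero] at h
      have two12 : (∀ a ∈ A1, f (Em 1 a) = 0) → (∀ b ∈ A2, f (Em 2 b) = 0) → False := by
        intro z1 z2
        refine hnot ⟨z1, z2, fun c hc => ?_⟩
        obtain ⟨y, hy, rfl⟩ := Submodule.mem_map.1 hc
        have h := hsumW y hy
        have e1 : f (Em 1 (row y 1)) = 0 := z1 _ (Submodule.mem_map_of_mem hy)
        have e2 : f (Em 2 (row y 2)) = 0 := z2 _ (Submodule.mem_map_of_mem hy)
        rwa [e1, e2, zero_add, zero_add] at h
      by_cases z1 : ∀ a ∈ A1, f (Em 1 a) = 0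
      · have n2 : ∃ b ∈ A2, (f ∘ₗ Em 2) b ≠ 0 := by
          by_contra h; push Not at h; exact two12 z1 h
        have n3 : ∃ c ∈ A3, (f ∘ₗ Em 3) c ≠ 0 := by
          by_contra h; push Not at h; exact two13 z1 h
        have h := T3_vanish_of_hyperplane A2 A3 A1 (f ∘ₗ Em 2) (f ∘ₗ Em 3) (f ∘ₗ Em 1) n2 n3
          (fun b hb c hc a ha hsum l => by
            rw [T3_swap₁₃, T3_swap₂₃]
            refine key a ha b hb c hc ?_ l
            simp only [LinearMap.comp_apply] at hsum
            linear_combination hsum)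
        intro a ha b hb c hc l
        rw [T3_swap₁₃, T3_swap₁₂]
        exact h b hb c hc a ha l
      · have n1 : ∃ a ∈ A1, (f ∘ₗ Em 1) a ≠ 0 := by
          by_contra h; push Not at h; exact z1 h
        by_cases z2 : ∀ b ∈ A2, f (Em 2 b) = 0
        · have n3 : ∃ c ∈ A3, (f ∘ₗ Em 3) c ≠ 0 := by
            by_contra h; push Not at h; exact two23 z2 h
          have h := T3_vanish_of_hyperplane A1 A3 A2 (f ∘ₗ Em 1) (f ∘ₗ Em 3) (f ∘ₗ Em 2) n1 n3
            (fun a ha c hc b hb hsum l => by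
              rw [T3_swap₂₃]
              refine key a ha b hb c hc ?_ l
              simp only [LinearMap.comp_apply] at hsum
              linear_combination hsum)
          intro a ha b hb c hc l
          rw [T3_swap₂₃]
          exact h a ha c hc b hb l
        · have n2 : ∃ b ∈ A2, (f ∘ₗ Em 2) b ≠ 0 := by
            by_contra h; push Not at h; exact z2 h
          exact T3_vanish_of_hyperplane A1 A2 A3 (f ∘ₗ Em 1) (f ∘ₗ Em 2) (f ∘ₗ Em 3) n1 n2
            (fun a ha b hb c hc hsum l => by
              refine key a ha b hb c hc ?_ l
              simpa only [LinearMap.comp_apply] using hsum)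
  -- the toric triple lemma: two common zero coordinates, hence a zero column
  obtain ⟨p, q, -, h1, h2, h3⟩ := toricTriple permOrthPairs A1 A2 A3 hn1 hn2 hn3 hT
  obtain ⟨y, hy, x, hne⟩ := hcol p
  apply hne
  fin_cases x
  · exact congr_fun (hi y hy) p
  · exact (h1 _ (Submodule.mem_map_of_mem hy)).1
  · exact (h2 _ (Submodule.mem_map_of_mem hy)).1
  · exact (h3 _ (Submodule.mem_map_of_mem hy)).1

end Summit.ValiantsHypothesis.ValiantsHypothesis.Theorems.SymPencilPerFourOneRowToric
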